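import Summits.NavierStokesRegularity.NavierStokesRegularity.Theses.StretchingWellBinding
import Summits.NavierStokesRegularity.NavierStokesRegularity.Theses.TerminalTrace
import Summits.NavierStokesRegularity.NavierStokesRegularity.Theorems.TerminalTraceBlowupHasSingularPoint
import Summits.NavierStokesRegularity.NavierStokesRegularity.Theorems.BlowupAssembly
import Summits.NavierStokesRegularity.NavierStokesRegularity.Theorems.AdiabaticEddyClayUniqueness
import Summits.NavierStokesRegularity.NavierStokesRegularity.Theorems.QuarterJoltEdgeLaw
import Summits.NavierStokesRegularity.NavierStokesRegularity.Theorems.StretchingWellBindingEnstrophyQuarterLawTraceTransferGlue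
import Summits.NavierStokesRegularity.NavierStokesRegularity.Theorems.StretchingWellBindingEnstrophyQuarterLawTraceTransferFastL3
import Summits.NavierStokesRegularity.NavierStokesRegularity.Theorems.StretchingWellBindingEnstrophyQuarterLawTraceTransferSlowSet
import Summits.NavierStokesRegularity.NavierStokesRegularity.Theorems.StretchingWellBindingEnstrophyQuarterLawTraceTransferESSVertex
import HarnessLib.Audit

/-!
# Line «trace_transfer» on the shelf crux `StretchingWellBinding.EnstrophyQuarterLaw` (stmt-NavierStokesRegularity-1574)

LINE 9 of seat ns-idea-9 (generation 4, lens «wuc» = weakest-unknown-consequence). A THEOREM-LINE on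
the shelf: it does not attack the quarter law, it computes what the quarter law DECIDES about the
terminal slice `u(T)` of a blow-up, and thereby closes — on shelf 1574 — the two open support items
of route TerminalTrace that speak the L³-trace currency:

* target decls BY NAME: `Theses.TerminalTrace.TraceScarL3` (stmt-NavierStokesRegularity-18384, open, M)
  and its Type-I cell `Theses.TerminalTrace.TypeITraceScarL3` (stmt-NavierStokesRegularity-18385, open, L;
  heavily staffed via Morrey zooms + extinction Liouville + half-space backward uniqueness);
* kernel-checked here: `EnstrophyQuarterLaw → TraceScarL3` and `EnstrophyQuarterLaw → TypeITraceScarL3`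
  modulo five registered stubs, and the summit edge
  `EnstrophyQuarterLaw → (NavierStokesRegularity ↔ L3Trace)` where `L3Trace` ("the terminal slice of a
  maximal Fefferman-class solution is locally L³ at every point") is the typed weakest consequence of
  the summit in the FINAL-PROFILE currency that closes the summit GIVEN the shelf, by a theorem and not
  by a further open support (contrast LINE 4 `QuarterBudgetTrace`: EQL ∧ NoTraceConcentration needs the
  open support stmt-26014; LINE 5 `QuarterJolt`: jolt-rate currency).

No summit is proved by this line; nothing here proves `EnstrophyQuarterLaw` or `NavierStokesRegularity`.

## The lever: TRACE TRANSFER UNDER THE EDGE LAW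

Write `λ(s) = (T−s)^{-1/2}` (the self-similar velocity threshold, constants dropped) and split every
late slice `u(s) = u(s)𝟙_{|u(s)|>λ(s)} + u(s)𝟙_{|u(s)|≤λ(s)}` (fast + slow part).

1. EDGE LAW (`stub_edgeLaw`; = the D = O(1) law planned by the NoTerminalJolt lead, Cruxes/NoTerminalJolt/
   Lines/regular_split.md §"edge law"): under the slice law `Ω(t) ≤ K(T−t)^{-1/2}` the L²-distance to the
   terminal slice obeys `‖u(s) − u(T)‖₂² ≤ D √(T−s)`. Proof plan (energy method, no spectral input): for
   t < s < T put y(s) = ‖u(s) − u(t)‖₂²; the energy inequality, ⟨(u·∇u)(τ), u(τ)⟩ = 0 and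
   ab − a² ≤ b²/4 give `y(s) ≤ (ν/2)(s−t)Ω(t) + 2∫_t^s ‖u‖_∞‖∇u‖₂ √y dτ`; with the sup-rate Type I that
   the quarter law implies (stmt-22145 `RecordTimeTypeI`, PROVED: ‖u(τ)‖_∞ ≤ C_I√ν (T−τ)^{-1/2}) and the
   slice law, `Y ≤ B + 2A√Y` with B = νK√(T−t), A = 4C_I√(νK)(T−t)^{1/4}`, so Y ≤ 4A² + 2B =
   (64C_I² + 2)νK √(T−t); let s ↑ T by weak-L² lower semicontinuity (Leray–Hopf weak continuity pins u T).
2. FAST PART (`stub_fastL3`; Sobolev–Chebyshev): ‖u(s)‖₆⁶ ≤ C_S⁶ ‖∇u(s)‖₂⁶ = C_S⁶ Ω(s)³ ≤ C_S⁶K³(T−s)^{-3/2},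
   hence `∫_{|u(s)|>λ(s)} |u(s)|³ ≤ λ(s)^{-3} ‖u(s)‖₆⁶ ≤ C_S⁶ K³` — bounded up to T.
3. TRACE TRANSFER (`stub_traceTransfer`; pure measure theory, the new move): on the slow set
   S = {|u(s)| ≤ λ(s)} ∩ B(x₀,ρ) put w = u(s) − u(T) and X = ‖w 𝟙_S‖₃. Since |w| ≤ |u(s)| + |u(T)|,
   `X³ ≤ ∫_S (|u(s)| + |u(T)|)|w|² ≤ λ(s)‖w‖₂² + ‖u(T)‖_{L³(B)} X²  ≤  D + ‖u(T)‖_{L³(B)} X²`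
   (edge law; λ(s)√(T−s) = 1; Hölder 1/3 + 2/3), so `X ≤ max((2D)^{1/3}, 2‖u(T)‖_{L³(B)})` and
   `‖u(s)‖_{L³(B(x₀,ρ))} ≤ (C_S⁶K³)^{1/3} + X + ‖u(T)‖_{L³(B)}` for all late s: the integrability of ONE
   slice (the terminal one) transfers to all late slices below the Type-I threshold, the fast part being
   paid by the quarter law. (Same algebra in weak-L³: u(T) ∈ L^{3,∞} ⇒ the weak-L³ Type-I bound of TIQG's
   crux stmt-24108 holds near T — recorded in the card, not typed here.)
4. LOCAL L³ CRITERION (`stub_regular_of_localSliceL3`): a Fefferman-class solution whose L³(B(x₀,ρ))-slices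
   stay bounded on (t₀,T) is essentially bounded on a backward parabolic cylinder at (T,x₀) — the tree's
   DISCHARGED Escauriaza–Seregin–Šverák local theorem `Literature.Analysis.FluidPDE.ess_local_holder_holds`
   (ESS 2003 Thm 1.4) run at the vertex (T,x₀) after the viscosity-normalising parabolic rescaling; template
   = `Theorems.CertifiedBlowupAxisymBlowup.CompactAmplification.isBoundedNearTop_of_setLIntegral_ball_le`
   (whose `AxisymmetricL3Hyp.axisymmetric` field is not used by that proof) + `IsBoundedNearTop → eLpNorm < ⊤`.
5. GLUE (`stub_not_hasSmoothExtensionPast_of_backwardSingular`): a backward-singular vertex (T,x₀) forbids a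
   smooth extension past T (the extension is continuous on a compact neighbourhood of the closed cylinder).

Composition: at a backward-singular point x₀ with u(T) ∈ L³(B(x₀,ρ)), 5 makes T maximal, the quarter law
gives K, 1–3 bound the L³(B(x₀,ρ)) slices, 4 bounds u near (T,x₀) — contradiction. Hence EQL ⇒ TraceScarL3.

## Ladder meaning / labels (ideator protocol D-0145)
* bears_on: stmt-1574 (shelf), stmt-18384, stmt-18385 (targets), stmt-26463 (shares `stub_edgeLaw` with the
  NoTerminalJolt lead's planned edge law), stmt-24108 (weak-L³ variant, card only).
* `L3Trace ⟺_EQL NavierStokesRegularity` (both directions typed below): ZERO independent width — L3Trace is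
  summit-equivalent on the shelf BY THIS LINE'S THEOREM; it is booked as a calibration currency, not as a
  new residual. The content of the line is the implication EQL ⇒ TraceScarL3 (a cross-shelf edge
  1574 → 18384 → 18385) and the trace-transfer lever.
* Not known in print for the quarter-law / sup-rate Type-I class: the printed trace theorems
  (Choe–Wolf–Yang 2019 Thm 1, Seregin 2019 Prop 1.3, Barker–Prange 2021 Props 7–8 = tree facts
  `barkerPrange2021_typeI_regular_of_small_weakL3/_sparse_profile`, Albritton–Barker 2020 Thm 3.1 = tree fact
  `albrittonBarker2020_localWeakL3_regularity`) all assume the WEAK-L³ Type-I bound sup_t‖u(t)‖_{L^{3,∞}} ≤ M,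
  which the quarter law does not supply (that is TIQG's open crux stmt-24108); the mechanism here is the
  elementary L²-edge-law transfer, not compactness of zooms + backward uniqueness.
* Cheapest falsifier / instrument row: a (numerical or exact) blow-up whose enstrophy follows Leray's rate
  Ω ≍ (T−t)^{-1/2} but whose terminal profile is locally L³ at the singular point (|u(T,x)| = o(|x−x₀|^{-1})
  in L³-mean, e.g. a fitted profile exponent γ < 1) contradicts `EnstrophyQuarterLaw → TraceScarL3`; since
  that implication is theorem-grade (mod stubs 1–5), such a dataset is not EQL-consistent — the instrument
  reading "γ ≥ 1 at every singular point" is a NECESSARY signature of the quarter-law scenario.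
-/

set_option linter.dupNamespace false
set_option linter.unusedVariables false

noncomputable section

open MeasureTheory Set Function Metric
open scoped ENNReal NNReal

namespace Summit.NavierStokesRegularity.NavierStokesRegularity.Cruxes.EnstrophyQuarterLaw.TraceTransfer

open Literature.Analysis.FluidPDE

/-! ### Currencies (bodies quantified per solution; frame = Fefferman class of the shelf crux) -/

/-- SLICE LAW with constant `K` on `[0,T)`: literally the body of `EnstrophyQuarterLaw`'s conclusion. -/
def SliceLaw (T : ℝ) (u : ℝ → EuclideanSpace ℝ (Fin 3) → EuclideanSpace ℝ (Fin 3)) (K : ℝ) : Prop :=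
  ∀ t ∈ Set.Ico 0 T, ∫⁻ x, ‖curl (u t) x‖ₑ ^ 2 ≤ ENNReal.ofReal (K / Real.sqrt (T - t))

/-- EDGE BOUND with constant `D` on `[t₀,T)`: `‖u(s) − u(T)‖₂² ≤ D √(T−s)` (lintegral form; `u T` is the
Leray–Hopf terminal slice = weak-L² limit). -/
def EdgeBound (T : ℝ) (u : ℝ → EuclideanSpace ℝ (Fin 3) → EuclideanSpace ℝ (Fin 3)) (D t₀ : ℝ) : Prop :=
  ∀ s ∈ Set.Ico t₀ T, ∫⁻ x, ‖u s x - u T x‖ₑ ^ 2 ≤ ENNReal.ofReal (D * Real.sqrt (T - s))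

/-- FAST-PART L³ BOUND with constant `C` on `[t₀,T)`: the cubic mass of `u(s)` above the self-similar
threshold `λ(s) = (T−s)^{-1/2}` stays bounded. -/
def FastL3Bound (T : ℝ) (u : ℝ → EuclideanSpace ℝ (Fin 3) → EuclideanSpace ℝ (Fin 3)) (C t₀ : ℝ) : Prop :=
  ∀ s ∈ Set.Ico t₀ T,
    ∫⁻ x in {x | (Real.sqrt (T - s))⁻¹ < ‖u s x‖}, ‖u s x‖ₑ ^ 3 ≤ ENNReal.ofReal C

/-- LOCAL L³ SLICE BOUND near `x₀` at radius `ρ` on a terminal time window `(t₀,T)`. -/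
def LocalSliceL3Bound (T : ℝ) (u : ℝ → EuclideanSpace ℝ (Fin 3) → EuclideanSpace ℝ (Fin 3))
    (x₀ : EuclideanSpace ℝ (Fin 3)) (ρ : ℝ) : Prop :=
  ∃ C t₀ : ℝ, t₀ < T ∧ ∀ s ∈ Set.Ioo t₀ T, ∫⁻ x in ball x₀ ρ, ‖u s x‖ₑ ^ 3 ≤ ENNReal.ofReal C

/-! ### Route-level statements of the line -/

/-- **EDGE LAW** (obligation Prop; = the NoTerminalJolt lead's planned `D = O(1)` law): in the Fefferman frame
the slice law forces `‖u(s) − u(T)‖₂² ≤ D√(T−s)` on a terminal window. A consequence of the summit (vacuously)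
and of the shelf crux (by the energy method of the module docstring, step 1). -/
def EdgeLaw : Prop :=
  ∀ (ν T : ℝ), 0 < ν → 0 < T →
    ∀ (u : ℝ → EuclideanSpace ℝ (Fin 3) → EuclideanSpace ℝ (Fin 3)) (p : ℝ → EuclideanSpace ℝ (Fin 3) → ℝ),
      IsClassicalNSSolutionOn (Set.Ico 0 T) ν 0 u p → IsLerayHopfOn T ν 0 (u 0) u →
      HasRapidSpatialDecay (u 0) → ∀ K : ℝ, SliceLaw T u K →
      ∃ D t₀ : ℝ, 0 ≤ t₀ ∧ t₀ < T ∧ EdgeBound T u D t₀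

/-- **L3Trace** — the «wuc» currency of this line: the terminal slice of a maximal Fefferman-class solution is
locally `L³` at every point. A consequence of the summit (no such solution exists, `l3Trace_of_navierStokesRegularity`);
GIVEN the shelf crux it implies the summit (`navierStokesRegularity_of_enstrophyQuarterLaw_of_l3Trace`), so on the
shelf it has no independent width — it is the calibration currency in which the quarter law is read. -/
def L3Trace : Prop :=
  ∀ (ν T : ℝ), 0 < ν → 0 < T →
    ∀ (u : ℝ → EuclideanSpace ℝ (Fin 3) → EuclideanSpace ℝ (Fin 3)) (p : ℝ → EuclideanSpace ℝ (Fin 3) → ℝ),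
      IsMaximalSmoothSolution ν 0 u p T → IsLerayHopfOn T ν 0 (u 0) u → HasRapidSpatialDecay (u 0) →
      ∀ x₀ : EuclideanSpace ℝ (Fin 3), ∃ ρ : ℝ, 0 < ρ ∧ MemLp (u T) 3 (volume.restrict (ball x₀ ρ))

/-! ### Registered stubs (the obligations; sizes in the line card)

ALL FIVE RETIRED BY NAME (2026-08-28, statements byte-identical, proofs = landed tree theorems, defeq):
S1 `stub_edgeLaw` := `Theorems.NoTerminalJolt.edgeLaw_lintegral` (ns-qj-p1 g2, `QuarterJoltEdgeLaw.lean`);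
S2–S5 := `Theorems.EnstrophyQuarterLaw.TraceTransfer.stub_*` (ns-hhe-c1 g4, KEY-NS #136 (1):
`…TraceTransferFastL3` p627021, `…TraceTransferSlowSet` p627524, `…TraceTransferESSVertex` p626696,
`…TraceTransferGlue` p626488; all `--supports stmt-NavierStokesRegularity-1574 --as helper`). The by-name
compositions below are also landed sorry-free as `Theorems/StretchingWellBindingEnstrophyQuarterLawTraceTransfer.lean`.
No summit statement is proved: EQL 1574 / 18384 / 18385 / 0056 stay OPEN. -/

/-- STUB 1 (L; shared with the NoTerminalJolt lead's plan): the slice law implies the edge law. -/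
theorem stub_edgeLaw : EdgeLaw :=
  Summit.NavierStokesRegularity.NavierStokesRegularity.Theorems.NoTerminalJolt.edgeLaw_lintegral

/-- STUB 2 (M; Sobolev `Ḣ¹ ⊂ L⁶` + Chebyshev in `L⁶`): the slice law bounds the cubic mass above the
self-similar threshold, `∫_{|u(s)|>(T−s)^{-1/2}} |u(s)|³ ≤ C_S⁶ K³`. -/
theorem stub_fastL3 :
    ∀ (ν T : ℝ), 0 < ν → 0 < T →
      ∀ (u : ℝ → EuclideanSpace ℝ (Fin 3) → EuclideanSpace ℝ (Fin 3)) (p : ℝ → EuclideanSpace ℝ (Fin 3) → ℝ),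
        IsClassicalNSSolutionOn (Set.Ico 0 T) ν 0 u p → IsLerayHopfOn T ν 0 (u 0) u →
        HasRapidSpatialDecay (u 0) → ∀ K : ℝ, SliceLaw T u K → ∃ C : ℝ, FastL3Bound T u C 0 :=
  Summit.NavierStokesRegularity.NavierStokesRegularity.Theorems.EnstrophyQuarterLaw.TraceTransfer.stub_fastL3

/-- STUB 3 (M; pure measure theory — TRACE TRANSFER): edge bound + fast bound + `u T ∈ L³(B(x₀,ρ))` ⇒ the
`L³(B(x₀,ρ))` norms of the late slices are bounded (`X³ ≤ D + ‖u T‖_{L³(B)} X²` on the slow set). -/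
theorem stub_traceTransfer :
    ∀ (ν T : ℝ), 0 < ν → 0 < T →
      ∀ (u : ℝ → EuclideanSpace ℝ (Fin 3) → EuclideanSpace ℝ (Fin 3)) (p : ℝ → EuclideanSpace ℝ (Fin 3) → ℝ),
        IsClassicalNSSolutionOn (Set.Ico 0 T) ν 0 u p → IsLerayHopfOn T ν 0 (u 0) u →
        ∀ (D t₀ C : ℝ), 0 ≤ t₀ → t₀ < T → EdgeBound T u D t₀ → FastL3Bound T u C 0 →
        ∀ (x₀ : EuclideanSpace ℝ (Fin 3)) (ρ : ℝ), 0 < ρ →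
          MemLp (u T) 3 (volume.restrict (ball x₀ ρ)) → LocalSliceL3Bound T u x₀ ρ :=
  Summit.NavierStokesRegularity.NavierStokesRegularity.Theorems.EnstrophyQuarterLaw.TraceTransfer.stub_traceTransfer

/-- STUB 4 (M; the tree's discharged ESS 2003 Thm 1.4 `ess_local_holder_holds` at the vertex `(T,x₀)`):
bounded `L³(B(x₀,ρ))` slices on a terminal window ⇒ `u` essentially bounded on a backward parabolic cylinder
at `(T,x₀)`. -/
theorem stub_regular_of_localSliceL3 :
    ∀ (ν T : ℝ), 0 < ν → 0 < T →
      ∀ (u : ℝ → EuclideanSpace ℝ (Fin 3) → EuclideanSpace ℝ (Fin 3)) (p : ℝ → EuclideanSpace ℝ (Fin 3) → ℝ),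
        IsClassicalNSSolutionOn (Set.Ico 0 T) ν 0 u p → IsLerayHopfOn T ν 0 (u 0) u →
        HasRapidSpatialDecay (u 0) → ∀ (x₀ : EuclideanSpace ℝ (Fin 3)) (ρ : ℝ), 0 < ρ →
        LocalSliceL3Bound T u x₀ ρ →
        ∃ r : ℝ, 0 < r ∧
          eLpNorm (uncurry u) ⊤ (volume.restrict (parabolicCylinder r (T, x₀))) < ⊤ :=
  Summit.NavierStokesRegularity.NavierStokesRegularity.Theorems.EnstrophyQuarterLaw.TraceTransfer.stub_regular_of_localSliceL3

/-- STUB 5 (S; glue): a backward-singular vertex `(T,x₀)` forbids a smooth extension past `T`. -/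
theorem stub_not_hasSmoothExtensionPast_of_backwardSingular :
    ∀ (ν T : ℝ), 0 < ν → 0 < T →
      ∀ (u : ℝ → EuclideanSpace ℝ (Fin 3) → EuclideanSpace ℝ (Fin 3)) (p : ℝ → EuclideanSpace ℝ (Fin 3) → ℝ),
        IsClassicalNSSolutionOn (Set.Ico 0 T) ν 0 u p → ∀ x₀ : EuclideanSpace ℝ (Fin 3),
        (∀ r : ℝ, 0 < r →
          eLpNorm (uncurry u) ⊤ (volume.restrict (parabolicCylinder r (T, x₀))) = ⊤) →
        ¬ HasSmoothExtensionPast ν 0 u T :=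
  Summit.NavierStokesRegularity.NavierStokesRegularity.Theorems.EnstrophyQuarterLaw.TraceTransfer.stub_not_hasSmoothExtensionPast_of_backwardSingular

/-! ### Kernel-checked compositions (no `sorry` below this line) -/

/-- **EQL ⇒ TraceScarL3** (stmt-1574 ⇒ stmt-18384): on the quarter-law shelf every backward-singular
vertex scars the terminal slice out of `L³` of every ball. -/
theorem traceScarL3_of_enstrophyQuarterLaw (hQ : Theses.StretchingWellBinding.EnstrophyQuarterLaw) :
    Theses.TerminalTrace.TraceScarL3 := by
  intro ν T hν hT u p hcl hLH hdec x₀ hsing ρ hρ hL3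
  have hmax : IsMaximalSmoothSolution ν 0 u p T :=
    ⟨hcl, stub_not_hasSmoothExtensionPast_of_backwardSingular ν T hν hT u p hcl x₀ hsing⟩
  obtain ⟨K, hK⟩ := hQ ν T hν hT u p hmax hLH hdec
  obtain ⟨D, t₀, ht₀, ht₀T, hD⟩ := stub_edgeLaw ν T hν hT u p hcl hLH hdec K hK
  obtain ⟨C, hC⟩ := stub_fastL3 ν T hν hT u p hcl hLH hdec K hK
  have hloc : LocalSliceL3Bound T u x₀ ρ :=
    stub_traceTransfer ν T hν hT u p hcl hLH D t₀ C ht₀ ht₀T hD hC x₀ ρ hρ hL3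
  obtain ⟨r, hr, hfin⟩ := stub_regular_of_localSliceL3 ν T hν hT u p hcl hLH hdec x₀ ρ hρ hloc
  exact absurd (hsing r hr) hfin.ne

/-- **EQL ⇒ TypeITraceScarL3** (stmt-1574 ⇒ stmt-18385): the Type-I cell follows a fortiori (the Type-I
hypothesis is not even used — the quarter law already pays the fast part). -/
theorem typeITraceScarL3_of_enstrophyQuarterLaw (hQ : Theses.StretchingWellBinding.EnstrophyQuarterLaw) :
    Theses.TerminalTrace.TypeITraceScarL3 :=
  fun ν T hν hT u p hcl hLH hdec _ x₀ hsing ρ hρ =>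
    traceScarL3_of_enstrophyQuarterLaw hQ ν T hν hT u p hcl hLH hdec x₀ hsing ρ hρ

/-- **Complete L³ blow-up on the shelf**: under the quarter law every maximal Fefferman-class solution has a
point at which the terminal slice lies in `L³` of NO ball. -/
theorem exists_l3Scar_of_enstrophyQuarterLaw (hQ : Theses.StretchingWellBinding.EnstrophyQuarterLaw) :
    ∀ (ν T : ℝ), 0 < ν → 0 < T →
      ∀ (u : ℝ → EuclideanSpace ℝ (Fin 3) → EuclideanSpace ℝ (Fin 3)) (p : ℝ → EuclideanSpace ℝ (Fin 3) → ℝ),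
        IsMaximalSmoothSolution ν 0 u p T → IsLerayHopfOn T ν 0 (u 0) u → HasRapidSpatialDecay (u 0) →
        ∃ x₀ : EuclideanSpace ℝ (Fin 3), ∀ ρ : ℝ, 0 < ρ → ¬ MemLp (u T) 3 (volume.restrict (ball x₀ ρ)) := by
  intro ν T hν hT u p hmax hLH hdec
  obtain ⟨xs, hxs⟩ :=
    Theorems.terminalTrace_blowupHasSingularPoint_proof ν T hν hT u p hmax.1 hLH hdec hmax.2
  exact ⟨xs, traceScarL3_of_enstrophyQuarterLaw hQ ν T hν hT u p hmax.1 hLH hdec xs hxs⟩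

/-- **Summit edge, direction ⇐**: the quarter law and the L³ trace together give Clay (A)
(via the PROVED local-theory assembly `NoBlowupToClay`). No summit is proved: both hypotheses are open. -/
theorem navierStokesRegularity_of_enstrophyQuarterLaw_of_l3Trace
    (hQ : Theses.StretchingWellBinding.EnstrophyQuarterLaw) (hL : L3Trace) : _root_.NavierStokesRegularity := by
  refine Theses.StretchingWellBinding.NoBlowupToClay_holds ?_
  intro ν T hν hT u p hcl hLH hdec
  by_contra hext
  obtain ⟨xs, hxs⟩ := exists_l3Scar_of_enstrophyQuarterLaw hQ ν T hν hT u p ⟨hcl, hext⟩ hLH hdec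
  obtain ⟨ρ, hρ, hmem⟩ := hL ν T hν hT u p ⟨hcl, hext⟩ hLH hdec xs
  exact hxs ρ hρ hmem

/-- **Summit edge, direction ⇒** (vacuity: under Clay (A) no Fefferman-class solution is maximal —
`blowup_assembly` with the PROVED Clay-class uniqueness `adiabaticEddy_clayUniqueness_proof`). -/
theorem l3Trace_of_navierStokesRegularity (hA : _root_.NavierStokesRegularity) : L3Trace := by
  intro ν T hν hT u p hmax hLH hdec x₀
  exact absurd hA (Literature.NS.blowup_assembly
    ⟨⟨ν, hν, T, hT, u, p, hmax, hLH, hdec⟩, Theorems.adiabaticEddy_clayUniqueness_proof⟩)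

/-- **On the shelf, Clay (A) ⟺ L3Trace** (zero independent width of the currency, booked). -/
theorem navierStokesRegularity_iff_l3Trace_of_enstrophyQuarterLaw
    (hQ : Theses.StretchingWellBinding.EnstrophyQuarterLaw) : _root_.NavierStokesRegularity ↔ L3Trace :=
  ⟨l3Trace_of_navierStokesRegularity, navierStokesRegularity_of_enstrophyQuarterLaw_of_l3Trace hQ⟩

end Summit.NavierStokesRegularity.NavierStokesRegularity.Cruxes.EnstrophyQuarterLaw.TraceTransfer

end
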